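import Summits.AtomisticToContinuum.FouriersLaw.Theses.CageBudgetFekete
import Summits.AtomisticToContinuum.FouriersLaw.Theorems.HeatVarianceCeiling.Negative.Rigidity
import Summits.AtomisticToContinuum.FouriersLaw.Theorems.CageBudgetFeketeHeatVarianceCalculus
import Summits.AtomisticToContinuum.FouriersLaw.Theorems.CurrentTiltQuenchSymmetricSetup
import Literature.MathematicalPhysics.KineticTheory.InfiniteChainShiftInvariantUniqueness

/-!
# `CageBudgetFekete.HeatVarianceCeiling` / Negative (4): the Drude kill template

Support file (`--supports stmt-AtomisticToContinuum-15770`) of the crux disprover of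
`Summit.AtomisticToContinuum.FouriersLaw.Theses.CageBudgetFekete.HeatVarianceCeiling`.

The route's own kill criterion ("a Drude atom — an odd conserved charge overlapping the current, Mazur —
gives `V(τ)/τ → ∞` and refutes C") made kernel-precise and reduced, by the rigidity of
`Negative/Rigidity.lean`, to a statement about ONE admissible pair:

* `setIntegral_sub_mul_eq_integral_primitive` — integration by parts,
  `∫_{(0,τ]}(τ-s)C(s)ds = ∫₀^τ Φ`, `Φ(s) = ∫₀^s C` (so `V = 2∫Φ`: the heat variance is the primitive of
  twice the running Green–Kubo integral);
* `not_ceiling_of_cesaro_floor` — real analysis: a positive CESÀRO FLOOR of a continuous memory,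
  `c·τ ≤ ∫₀^τ C` for `τ ≥ τ₀` with `c > 0` (a Drude weight, e.g. Mazur's lower bound
  `lim τ⁻¹∫₀^τ C ≥ Σ_k ⟨J,Q_k⟩²/⟨Q_k,Q_k⟩` from odd conserved charges `Q_k`,
  `Literature.Barriers.AtomisticToContinuum.Mazur1969_inequality`), makes `V(τ) ≥ c τ² + K`, hence no
  linear ceiling;
* `not_heatVarianceCeiling_of_cesaro_floor` — THE TEMPLATE: if at ONE admissible parameter point, for
  ONE shift-invariant DLR state `μ` and ONE dynamics `D` preserving it, the memory
  `t ↦ D.currentCorrelation μ t` has a positive Cesàro floor, then `HeatVarianceCeiling` is false (the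
  crux is instantiated at the proved symmetric set-up, transferred to `(μ, D)` by `ceiling_transfer`,
  and the memory of `D` is continuous because it IS the canonical one).

What would feed the template (none is in hand, which is why the crux stands): the disbelieved kill
switch `HiddenChargeMazur.OddChargeExists` (an odd local polynomial conservation law of the quartic
pinned chain — expected false: pinning leaves energy, which is even, as the only local charge), or a
quasi-local odd element of `Ker L ⊂ ℋ₀` (Doyon's completeness problem, neither constructible nor
excluded). No new definitions. refuter-cdisprove-stmt-AtomisticToContinuum-15770-0, 2026-08-17.
-/

noncomputable section

namespace Summit.AtomisticToContinuum.FouriersLaw.Theorems.HeatVarianceCeiling.Negative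

open MeasureTheory Filter Set Topology intervalIntegral
open Literature.MathematicalPhysics.KineticTheory.HeatConduction
open Summit.AtomisticToContinuum.FouriersLaw.Theorems

/-! ## §1 Real analysis -/

/-- **Integration by parts for the heat variance**: for continuous `C` and `τ ≥ 0`,
`∫_{(0,τ]} (τ-s) C(s) ds = ∫₀^τ (∫₀^s C) ds`. [folklore] -/
theorem setIntegral_sub_mul_eq_integral_primitive (C : ℝ → ℝ) (hC : Continuous C) {τ : ℝ}
    (hτ : 0 ≤ τ) :
    ∫ s in Ioc (0:ℝ) τ, (τ - s) * C s = ∫ s in (0:ℝ)..τ, (∫ u in (0:ℝ)..s, C u) := by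
  set Φ : ℝ → ℝ := fun s => ∫ u in (0:ℝ)..s, C u with hΦ
  have hΦd : ∀ s, HasDerivAt Φ (C s) s := fun s => (hC.integral_hasStrictDerivAt 0 s).hasDerivAt
  rw [← intervalIntegral.integral_of_le hτ]
  have h := intervalIntegral.integral_mul_deriv_eq_deriv_mul (a := 0) (b := τ)
    (u := fun s => τ - s) (u' := fun _ => -1) (v := Φ) (v' := C)
    (fun s _ => by simpa using (hasDerivAt_id s).const_sub τ)
    (fun s _ => hΦd s) intervalIntegrable_const (hC.intervalIntegrable 0 τ)
  simp only [sub_self, zero_mul, sub_zero, neg_mul, one_mul, intervalIntegral.integral_neg,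
    sub_neg_eq_add] at h
  rw [h]
  simp [hΦ, intervalIntegral.integral_same]

/-- **A Cesàro floor of the memory forbids a linear ceiling.** For continuous `C` with
`c·τ ≤ ∫₀^τ C` for all `τ ≥ τ₀` (`c > 0`): `V(τ) = 2∫_{(0,τ]}(τ-s)C(s)ds ≥ cτ² + K`, so
`¬ ∃ B τ₁, ∀ τ ≥ τ₁, V(τ) ≤ Bτ`. [folklore] -/
theorem not_ceiling_of_cesaro_floor (C : ℝ → ℝ) (hC : Continuous C) {c τ₀ : ℝ} (hc : 0 < c)
    (hD : ∀ τ, τ₀ ≤ τ → c * τ ≤ ∫ u in (0:ℝ)..τ, C u) :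
    ¬ ∃ B τ₁ : ℝ, ∀ τ : ℝ, τ₁ ≤ τ → 2 * ∫ s in Ioc (0:ℝ) τ, (τ - s) * C s ≤ B * τ := by
  rintro ⟨B, τ₁, hB⟩
  set Φ : ℝ → ℝ := fun s => ∫ u in (0:ℝ)..s, C u with hΦ
  have hΦd : ∀ s, HasDerivAt Φ (C s) s := fun s => (hC.integral_hasStrictDerivAt 0 s).hasDerivAt
  have hΦc : Continuous Φ := continuous_iff_continuousAt.2 fun s => (hΦd s).continuousAt
  set m₀ : ℝ := ∫ s in (0:ℝ)..τ₀, Φ s with hm₀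
  set K : ℝ := 2 * m₀ - c * τ₀ ^ 2 with hK
  -- a large time
  set τ : ℝ := max τ₁ (max τ₀ (max 1 ((|B| + |K|) / c + 1))) with hτdef
  have hτ1 : 1 ≤ τ := le_trans (le_max_left _ _) (le_trans (le_max_right _ _) (le_max_right _ _))
  have hττ₀ : τ₀ ≤ τ := le_trans (le_max_left _ _) (le_max_right _ _)
  have hτc : (|B| + |K|) / c + 1 ≤ τ :=
    le_trans (le_max_right _ _) (le_trans (le_max_right _ _) (le_max_right _ _))
  have hτ0 : 0 ≤ τ := by linarith
  have hVB := hB τ (le_max_left _ _)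
  rw [setIntegral_sub_mul_eq_integral_primitive C hC hτ0] at hVB
  -- lower bound `∫₀^τ Φ ≥ m₀ + c (τ² - τ₀²)/2`
  have hsplit : ∫ s in (0:ℝ)..τ, Φ s = m₀ + ∫ s in τ₀..τ, Φ s :=
    (intervalIntegral.integral_add_adjacent_intervals (hΦc.intervalIntegrable 0 τ₀)
      (hΦc.intervalIntegrable τ₀ τ)).symm
  have hlow : ∫ s in τ₀..τ, c * s ≤ ∫ s in τ₀..τ, Φ s :=
    intervalIntegral.integral_mono_on hττ₀ ((continuous_const.mul continuous_id).intervalIntegrable _ _)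
      (hΦc.intervalIntegrable _ _) fun s hs => hD s hs.1
  have hcs : ∫ s in τ₀..τ, c * s = c * (τ ^ 2 - τ₀ ^ 2) / 2 := by
    rw [intervalIntegral.integral_const_mul, integral_id]; ring
  have hge : c * τ ^ 2 + K ≤ B * τ := by
    rw [hK]; nlinarith [hsplit, hlow, hcs, hVB]
  -- contradiction: `c τ² + K > B τ` for `τ ≥ (|B|+|K|)/c + 1`, `τ ≥ 1`
  have h1 : |B| + |K| + c ≤ c * τ := by
    have := mul_le_mul_of_nonneg_left hτc hc.le
    rwa [mul_add, mul_div_cancel₀ _ hc.ne', mul_one] at this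
  have h2 : c * τ ^ 2 ≥ (|B| + |K| + c) * τ := by nlinarith
  have h3 : B * τ ≤ |B| * τ := mul_le_mul_of_nonneg_right (le_abs_self B) hτ0
  have h4 : -|K| ≤ K := neg_abs_le K
  nlinarith [abs_nonneg B, abs_nonneg K]

/-! ## §2 The template -/

/-- **Drude kill template for `HeatVarianceCeiling`.** If at ONE admissible parameter point
(`ω₂, lam, β > 0`, any `γ`, `T > 0`), for ONE shift-invariant DLR state `μ` and ONE dynamics `D`
preserving it, the summed current memory has a positive Cesàro floor
(`c·τ ≤ ∫₀^τ D.currentCorrelation μ` for `τ ≥ τ₀`, `c > 0` — a Drude weight), then the crux is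
FALSE. Proof: instantiate the crux at the proved symmetric set-up `(μ', D')` at the same point (its
convergence/continuity clauses are the proved `HeatVarianceCalculus`); `μ' = μ` and the heat variances
of `D'` and `D` coincide (`ceiling_transfer`), as do their memories
(`currentCorrelation_eq_of_preservesMeasure`), so the memory of `D` is continuous and
`not_ceiling_of_cesaro_floor` applies. [folklore] -/
theorem not_heatVarianceCeiling_of_cesaro_floor {ω₂ lam β : ℝ} (γ : ℝ) (hω : 0 < ω₂) (hl : 0 < lam)
    (hβ : 0 < β) {T : ℝ} (hT : 0 < T) {μ : Measure ChainConfig}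
    (hG : (pinnedChain ω₂ lam β γ).IsChainGibbsMeasure T μ) (hSI : IsShiftInvariant μ)
    (D : InfiniteChainDynamics (pinnedChain ω₂ lam β γ)) (hP : D.PreservesMeasure μ)
    {c τ₀ : ℝ} (hc : 0 < c)
    (hfloor : ∀ τ, τ₀ ≤ τ → c * τ ≤ ∫ u in (0:ℝ)..τ, D.currentCorrelation μ u) :
    ¬ Summit.AtomisticToContinuum.FouriersLaw.Theses.CageBudgetFekete.HeatVarianceCeiling := by
  intro hCeil
  obtain ⟨μ', hG', hS', hR', D', hP', hcov'⟩ :=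
    CurrentTiltQuench.cageBudgetFekete_symmetricSetup_proof ω₂ lam β γ hω hl hβ T hT
  obtain ⟨hAC', hCc', -⟩ :=
    HeatVarianceCalculus.CanonicalRigidity.heatVarianceCalculus_proof ω₂ lam β γ hω hl hβ T hT μ' hG'
      hS' hR' D' hP' hcov'
  obtain ⟨B, τ₁, hB⟩ := hCeil ω₂ lam β γ hω hl hβ T hT μ' hG' hS' hR' D' hP' hcov' hAC' hCc' _ rfl
  have hμ : μ' = μ :=
    OscillatorChain.eq_of_isChainGibbsMeasure_of_isShiftInvariant_pinnedChain γ hω hl.le hβ.le hT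
      hG' hS' hG hSI
  subst hμ
  have hCeq : (fun t : ℝ => D.currentCorrelation μ' t) = fun t => D'.currentCorrelation μ' t :=
    funext fun t => currentCorrelation_eq_of_preservesMeasure γ hω hl hβ hT hG' hS' D D' hP hP' t
  have hCc : Continuous fun t : ℝ => D.currentCorrelation μ' t := by rw [hCeq]; exact hCc'
  refine not_ceiling_of_cesaro_floor (fun t => D.currentCorrelation μ' t) hCc hc hfloor ⟨B, τ₁, ?_⟩
  exact ceiling_transfer γ hω hl hβ hT hG' hS' hG' hS' D' D hP' hP hB

end Summit.AtomisticToContinuum.FouriersLaw.Theorems.HeatVarianceCeiling.Negative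

end
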